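import Summits.QuantumFields.YangMills.Theorems.BalabanLadderNTSharpPlaquetteMoments
import Summits.QuantumFields.YangMills.Theorems.BalabanLadderNTCeilingPrice
import Summits.QuantumFields.YangMills.Theorems.BalabanLadderIRAfOnsetLatticeAF
import HarnessLib

/-!
# Crux `NT` (stmt-QuantumFields-19353): the SHARP volume-uniform THREE-point ceiling — `|torusK3_{T,β}(x,y,z)| ≤ W/β³`,
# `|Q3| ≤ K/(β³·min(s,1)¹²)`, and the unit envelope `a(β) ≤ K·β^{−1/4}` from clause (ii) alone — NO logarithm, hypothesis-free

Fleet lead prover of crux `NT` (unit `ym-spine-19353-p1`, g28), `--supports` helper; sequel of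
`Theorems/BalabanLadderNTSharpPlaquetteMoments` (the exponential plaquette tail and the sharp moments `⟨φ_q^p⟩ ≤ K_p/β^p` of EVERY
order on every odd torus at every `β ≥ 4`, from the torus doubling of crux `FemtoCurvatureTwoPointC`).  Clause (ii) of
`LowerBounds G r a` floors `|Q3_{β,L,a(β)}(f, g, h)| = |Σ f g h · torusK3_T(x, y, z)|`; the tree had NO volume-uniform weak-coupling
ceiling for the torus third cumulant of the action density (only the β-integrated `k = 0` budget of `CouplingSumRuleCumulant` and the
E1-osc-conditional `CeilingPrice.abs_torusK3_le_of_e1osc`).  Third moments make it immediate: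

* §1 `abs_prod_sub_le_cubes` — pointwise: for `u, v, w, p, q, s ≥ 0`, `|(p − u)(q − v)(s − w)| ≤ (4/3)(u³ + v³ + w³ + p³ + q³ + s³)`
  (AM–GM for three cubes and `(a + b)³ ≤ 4(a³ + b³)`, inlined).
* §2 **`exists_abs_torusK3_le_sharp`** — there is `W ≥ 0` with `|torusK3_{T,β}(x, y, z)| ≤ W/β³` for ALL sites `x, y, z`, every odd torus
  `2L+1 ≥ 3` and every `β ≥ 4` (the third cumulant is the centred third moment, `CeilingPrice.torusE_prod_centred_three_eq_torusCum3`; centre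
  `A_w = 6N − Φ_w`, `Φ_w = Σ_q φ_q ≥ 0`, around `6N − E_T[A_w] ∈ [0, 6K/β]` (the sharp one-point ceiling); §1; `E_T[Φ_w³] ≤ 6²Σ_q⟨φ_q³⟩
  ≤ 6³K₃/β³`).  No decay in the separations is claimed.
* §3 **`exists_abs_Q3_le_sharp`** — `|Q3 G r β L s f g h| ≤ K/(β³·min(s,1)¹²)` for all `L ≥ 1`, `β ≥ 4`, `s > 0` and any test functions
  (`CeilingPrice.abs_Q3_le_of_pointwise` and the Schwartz lattice sums `AfOnset.exists_sum_abs_schwartz_lattice_le_div_min`).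
* §4 **the unit envelope from clause (ii)**: `unit_pow_twelve_le_of_q3Floor_sharp` (`min(a β,1)¹²·β³ ≤ K`), **`unit_pow_twelve_le_of_lowerBounds`**
  (eventually `a β < 1 ∧ a β¹² ≤ K/β³`): clause (ii) ALONE pins an NT unit at the SAME power `β^{−1/4}` as clause (i) does (taking twelfth
  roots gives exactly the landed envelope `SharpCeilings.unit_le_rpow_of_lowerBounds` of `…SharpTwoPointCeiling`, not restated here).

HONEST FRAMING.  CEILINGS and an envelope — the exact perturbative power `β⁻³` of the bare three-point function, uniformly in the volume,
for every compact gauge group; nothing of NT's β-uniform FLOOR on `|Q3|` at lattice momenta `|k| ≍ a(β)` (whose sign is one-loop-hard),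
the seam or the gap.  NT is NOT proved; the Yang–Mills mass gap is NOT proved; not Clay.
-/

set_option autoImplicit false

noncomputable section

open MeasureTheory Filter Topology Finset
open scoped BigOperators SchwartzMap
open Literature.MathematicalPhysics.QuantumFieldTheory hiding ZdEdge
open Literature.MathematicalPhysics.QuantumLattice
open Literature.Probability.LatticeModels (box mem_box)
open Summit.QuantumFields.YangMills.Cruxes.OSLegsFromFemtoAndGap.DlrCollarTransfer
open Summit.QuantumFields.YangMills.Cruxes.IR.AfOnset (dens_torusLift_eq exists_sum_abs_schwartz_lattice_le_div_min)
open Summit.QuantumFields.YangMills.Theorems.CurvatureBoostCovariance.Negative (card_planes)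
open Summit.QuantumFields.YangMills.Cruxes.NT.CouplingSumRule (torusE_dens_le)
open Literature.MathematicalPhysics.QuantumFieldTheory.WilsonRP (plaqRe abs_plaqRe_le measurable_plaqRe)

namespace Summit.QuantumFields.YangMills.Cruxes.NT.SharpCeilings

/-! ## §1 Pointwise algebra -/

/-- **Pointwise bound on a centred triple product**: for `u, v, w, p, q, s ≥ 0`,
`|(p − u)(q − v)(s − w)| ≤ (4/3)·(u³ + v³ + w³ + p³ + q³ + s³)` (`|p − u| ≤ p + u`, AM–GM for three cubes — the tree's
`ChainVariation.mul_mul_le_add_pow_three` / `FluidPDE.Torus.add_pow_three_le` pattern, inlined — and `(a + b)³ ≤ 4(a³ + b³)`). [folklore] -/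
theorem abs_prod_sub_le_cubes {u v w p q s : ℝ} (hu : 0 ≤ u) (hv : 0 ≤ v) (hw : 0 ≤ w) (hp : 0 ≤ p)
    (hq : 0 ≤ q) (hs : 0 ≤ s) :
    |(p - u) * (q - v) * (s - w)| ≤ 4 / 3 * (u ^ 3 + v ^ 3 + w ^ 3 + p ^ 3 + q ^ 3 + s ^ 3) := by
  -- `(a + b)³ ≤ 4(a³ + b³)` and AM–GM for three cubes, `a b c ≤ (a³ + b³ + c³)/3`, on non-negative reals
  have cube2 : ∀ a b : ℝ, 0 ≤ a → 0 ≤ b → (a + b) ^ 3 ≤ 4 * (a ^ 3 + b ^ 3) := fun a b ha hb => by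
    nlinarith [mul_nonneg (add_nonneg ha hb) (sq_nonneg (a - b)), mul_nonneg ha hb]
  have cube3 : ∀ a b c : ℝ, 0 ≤ a → 0 ≤ b → 0 ≤ c → a * b * c ≤ (a ^ 3 + b ^ 3 + c ^ 3) / 3 :=
    fun a b c ha hb hc => by
      have key : 0 ≤ (a + b + c) * ((a - b) ^ 2 + (b - c) ^ 2 + (c - a) ^ 2) :=
        mul_nonneg (by positivity) (by positivity)
      nlinarith [key]
  have h1 : |p - u| ≤ p + u := abs_le.2 ⟨by linarith, by linarith⟩
  have h2 : |q - v| ≤ q + v := abs_le.2 ⟨by linarith, by linarith⟩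
  have h3 : |s - w| ≤ s + w := abs_le.2 ⟨by linarith, by linarith⟩
  rw [abs_mul, abs_mul]
  have hpu : 0 ≤ p + u := by positivity
  have hqv : 0 ≤ q + v := by positivity
  have hsw : 0 ≤ s + w := by positivity
  calc |p - u| * |q - v| * |s - w| ≤ (p + u) * (q + v) * (s + w) := by
        gcongr
    _ ≤ ((p + u) ^ 3 + (q + v) ^ 3 + (s + w) ^ 3) / 3 := cube3 _ _ _ hpu hqv hsw
    _ ≤ (4 * (p ^ 3 + u ^ 3) + 4 * (q ^ 3 + v ^ 3) + 4 * (s ^ 3 + w ^ 3)) / 3 := by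
        gcongr
        · exact cube2 p u hp hu
        · exact cube2 q v hq hv
        · exact cube2 s w hs hw
    _ = 4 / 3 * (u ^ 3 + v ^ 3 + w ^ 3 + p ^ 3 + q ^ 3 + s ^ 3) := by ring

/-! ## §2 The sharp three-point ceiling for the action density -/

section K3

variable {G : Type} [Group G] [TopologicalSpace G] [IsTopologicalGroup G] [CompactSpace G]
  [MeasurableSpace G] [BorelSpace G] (r : LatticeRep G)

/-- **Volume-uniform bound for the torus third cumulant of the action density at weak coupling, NO logarithm.**  There is
`W ≥ 0` with `|torusK3_{β, 2L+1}(x, y, z)| ≤ W/β³` for all sites `x, y, z ∈ ℤ⁴`, every odd torus `2L+1 ≥ 3` and every `β ≥ 4`. [folklore] -/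
theorem exists_abs_torusK3_le_sharp :
    ∃ W : ℝ, 0 ≤ W ∧ ∀ (L : ℕ), 1 ≤ L → ∀ β : ℝ, 4 ≤ β → ∀ x y z : Fin 4 → ℤ,
      |torusK3 G r β L x y z| ≤ W / β ^ 3 := by
  haveI : SecondCountableTopology G :=
    (r.continuous.isClosedEmbedding r.injective).isEmbedding.secondCountableTopology
  obtain ⟨K₁, hK₁0, hK₁⟩ := exists_six_mul_sub_torusE_dens_le_sharp G r
  obtain ⟨K₃, hK₃0, hK₃⟩ := exists_plaquetteCost_rpow_le r (p := 3) (by norm_num)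
  obtain ⟨m, hmdef⟩ : ∃ m : ℝ, m = (Fintype.card {q : Fin 4 × Fin 4 // q.1 < q.2} : ℝ) := ⟨_, rfl⟩
  have hm6 : m = 6 := by rw [hmdef, card_planes]; norm_num
  have hm0 : 0 ≤ m := by rw [hm6]; norm_num
  obtain ⟨N, hNdef⟩ : ∃ N : ℝ, N = (r.N : ℝ) := ⟨_, rfl⟩
  have hN0 : 0 ≤ N := by rw [hNdef]; exact Nat.cast_nonneg _
  -- `W = (4/3)·3·(m³ K₃ + (6K₁)³)`
  refine ⟨4 * (m ^ 3 * K₃ + (6 * K₁) ^ 3), by positivity, fun L hL β hβ x y z => ?_⟩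
  have hβ0 : 0 < β := by linarith
  have hM3 : 3 ≤ 2 * L + 1 := by omega
  have hodd : Odd (2 * L + 1) := odd_two_mul_add_one L
  haveI := isProbabilityMeasure_wilsonMeasure (d := 4) (L := 2 * L + 1) r.ρ r.continuous β
  -- per-plaquette facts
  have hq : ∀ q : Plaquette 4 (2 * L + 1),
      Measurable (fun U : GaugeConfig 4 (2 * L + 1) G => plaquetteCost r.ρ U q) ∧
      (∀ U, 0 ≤ plaquetteCost r.ρ U q ∧ plaquetteCost r.ρ U q ≤ 2 * N) := by
    intro q
    refine ⟨measurable_const.sub (measurable_plaqRe r.ρ r.continuous q), fun U => ?_⟩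
    have h := abs_le.1 (abs_plaqRe_le r.ρ r.continuous U q)
    change 0 ≤ (r.N : ℝ) - plaqRe r.ρ U q ∧ (r.N : ℝ) - plaqRe r.ρ U q ≤ 2 * N
    rw [← hNdef] at h ⊢
    constructor <;> linarith [h.1, h.2]
  have hmom3 : ∀ q : Plaquette 4 (2 * L + 1),
      ∫ U, plaquetteCost r.ρ U q ^ 3 ∂(wilsonMeasure (d := 4) (L := 2 * L + 1) r.ρ β) ≤ K₃ / β ^ 3 := by
    intro q
    have h := hK₃ (2 * L + 1) β hodd hM3 hβ q
    have e3 : ∀ t : ℝ, t ^ (3 : ℝ) = t ^ (3 : ℕ) := fun t => by exact_mod_cast Real.rpow_natCast t 3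
    simp only [e3] at h
    exact h
  have hq3int : ∀ q : Plaquette 4 (2 * L + 1),
      Integrable (fun U : GaugeConfig 4 (2 * L + 1) G => plaquetteCost r.ρ U q ^ 3)
        (wilsonMeasure (d := 4) (L := 2 * L + 1) r.ρ β) := fun q =>
    integrable_of_bound ((hq q).1.pow_const 3).aestronglyMeasurable (C := (2 * N) ^ 3) fun U => by
      rw [abs_of_nonneg (pow_nonneg ((hq q).2 U).1 3)]; exact pow_le_pow_left₀ ((hq q).2 U).1 ((hq q).2 U).2 3
  -- the plaquette sums `Φ_w`
  obtain ⟨Φ, hΦ⟩ : ∃ Φ : (Fin 4 → ℤ) → GaugeConfig 4 (2 * L + 1) G → ℝ, ∀ w, Φ w = fun U =>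
      ∑ q : {q : Fin 4 × Fin 4 // q.1 < q.2},
        plaquetteCost r.ρ U (Literature.Probability.LatticeModels.Torus.proj (2 * L + 1) w, q) :=
    ⟨_, fun _ => rfl⟩
  have hdens : ∀ (w : Fin 4 → ℤ) (U : GaugeConfig 4 (2 * L + 1) G),
      dens G r w (torusLift (2 * L + 1) U) = 6 * N - Φ w U := by
    intro w U
    rw [dens_torusLift_eq, Finset.sum_sub_distrib, hΦ w, Finset.sum_const, Finset.card_univ, card_planes, nsmul_eq_mul, hNdef]
    push_cast; ring
  have hΦm : ∀ w, Measurable (Φ w) := fun w => by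
    rw [hΦ w]; exact Finset.measurable_sum _ fun q _ => (hq _).1
  have hΦ0 : ∀ w U, 0 ≤ Φ w U := fun w U => by
    rw [hΦ w]; exact Finset.sum_nonneg fun q _ => ((hq _).2 U).1
  have hΦB : ∀ w U, Φ w U ≤ m * (2 * N) := by
    intro w U
    rw [hΦ w]
    calc ∑ q : {q : Fin 4 × Fin 4 // q.1 < q.2},
          plaquetteCost r.ρ U (Literature.Probability.LatticeModels.Torus.proj (2 * L + 1) w, q)
        ≤ ∑ _q : {q : Fin 4 × Fin 4 // q.1 < q.2}, 2 * N := Finset.sum_le_sum fun q _ => ((hq _).2 U).2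
      _ = m * (2 * N) := by rw [Finset.sum_const, nsmul_eq_mul, Finset.card_univ, hmdef]
  have hΦ3int : ∀ w, Integrable (fun U => Φ w U ^ 3) (wilsonMeasure (d := 4) (L := 2 * L + 1) r.ρ β) := fun w =>
    integrable_of_bound ((hΦm w).pow_const 3).aestronglyMeasurable (C := (m * (2 * N)) ^ 3) fun U => by
      rw [abs_of_nonneg (pow_nonneg (hΦ0 w U) 3)]; exact pow_le_pow_left₀ (hΦ0 w U) (hΦB w U) 3
  -- third moments of `Φ_w`: `(Σ_q φ_q)³ ≤ m² Σ_q φ_q³`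
  have hcube : ∀ w, ∫ U, Φ w U ^ 3 ∂(wilsonMeasure (d := 4) (L := 2 * L + 1) r.ρ β) ≤ m ^ 3 * K₃ / β ^ 3 := by
    intro w
    have hpt : ∀ U, Φ w U ^ 3 ≤ m ^ 2 * ∑ q : {q : Fin 4 × Fin 4 // q.1 < q.2},
        plaquetteCost r.ρ U (Literature.Probability.LatticeModels.Torus.proj (2 * L + 1) w, q) ^ 3 := by
      intro U
      have h := pow_sum_le_card_mul_sum_pow (s := (Finset.univ : Finset {q : Fin 4 × Fin 4 // q.1 < q.2}))
        (f := fun q => plaquetteCost r.ρ U (Literature.Probability.LatticeModels.Torus.proj (2 * L + 1) w, q))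
        (fun q _ => ((hq _).2 U).1) 2
      rw [Finset.card_univ] at h
      rw [hΦ w, hmdef]
      exact_mod_cast h
    have hint0 : Integrable (fun U => ∑ q : {q : Fin 4 × Fin 4 // q.1 < q.2},
        plaquetteCost r.ρ U (Literature.Probability.LatticeModels.Torus.proj (2 * L + 1) w, q) ^ 3)
        (wilsonMeasure (d := 4) (L := 2 * L + 1) r.ρ β) :=
      integrable_finsetSum _ fun q _ => hq3int _
    calc ∫ U, Φ w U ^ 3 ∂(wilsonMeasure (d := 4) (L := 2 * L + 1) r.ρ β)
        ≤ ∫ U, m ^ 2 * ∑ q : {q : Fin 4 × Fin 4 // q.1 < q.2},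
            plaquetteCost r.ρ U (Literature.Probability.LatticeModels.Torus.proj (2 * L + 1) w, q) ^ 3
              ∂(wilsonMeasure (d := 4) (L := 2 * L + 1) r.ρ β) :=
          integral_mono (hΦ3int w) (hint0.const_mul _) hpt
      _ = m ^ 2 * ∑ q : {q : Fin 4 × Fin 4 // q.1 < q.2},
            ∫ U, plaquetteCost r.ρ U (Literature.Probability.LatticeModels.Torus.proj (2 * L + 1) w, q) ^ 3
              ∂(wilsonMeasure (d := 4) (L := 2 * L + 1) r.ρ β) := by
          rw [integral_const_mul, integral_finsetSum _ fun q _ => hq3int _]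
      _ ≤ m ^ 2 * ∑ _q : {q : Fin 4 × Fin 4 // q.1 < q.2}, K₃ / β ^ 3 :=
          mul_le_mul_of_nonneg_left (Finset.sum_le_sum fun q _ => hmom3 _) (by positivity)
      _ = m ^ 3 * K₃ / β ^ 3 := by rw [Finset.sum_const, nsmul_eq_mul, Finset.card_univ, ← hmdef]; ring
  -- the centres `ψ_w = 6N − E_T[A_w] ∈ [0, 6K₁/β]`
  set ψ : (Fin 4 → ℤ) → ℝ := fun w => 6 * N - torusE G r β L (dens G r w) with hψ
  have hψ0 : ∀ w, 0 ≤ ψ w := fun w => by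
    have h := torusE_dens_le G r β L w
    rw [← hNdef] at h
    show 0 ≤ 6 * N - torusE G r β L (dens G r w)
    linarith
  have hψle : ∀ w, ψ w ≤ 6 * K₁ / β := fun w => by
    have h := hK₁ L hL β hβ w
    rw [← hNdef] at h
    exact h
  have hψ3 : ∀ w, ψ w ^ 3 ≤ (6 * K₁) ^ 3 / β ^ 3 := fun w => by
    rw [← div_pow]; exact pow_le_pow_left₀ (hψ0 w) (hψle w) 3
  -- the third cumulant as a centred moment, read on the torus
  have hK3 : torusK3 G r β L x y z =
      ∫ U, (ψ x - Φ x U) * (ψ y - Φ y U) * (ψ z - Φ z U) ∂(wilsonMeasure (d := 4) (L := 2 * L + 1) r.ρ β) := by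
    rw [Summit.QuantumFields.YangMills.Cruxes.NT.CumulantPolarisation.torusK3_eq_torusCum3,
      ← Summit.QuantumFields.YangMills.Cruxes.NT.CeilingPrice.torusE_prod_centred_three_eq_torusCum3 G r β L
        (continuous_dens r x) (continuous_dens r y) (continuous_dens r z)]
    have h2 : (fun V => (dens G r x V - torusE G r β L (dens G r x)) * (dens G r y V - torusE G r β L (dens G r y)) *
        (dens G r z V - torusE G r β L (dens G r z))) =
        fun V => (ψ x - (6 * N - dens G r x V)) * (ψ y - (6 * N - dens G r y V)) * (ψ z - (6 * N - dens G r z V)) := by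
      funext V; simp only [hψ]; ring
    rw [h2]
    unfold torusE
    refine integral_congr_ae (ae_of_all _ fun U => ?_)
    simp only [hdens]
    ring
  -- pointwise bound and integration
  have hpt : ∀ U, |(ψ x - Φ x U) * (ψ y - Φ y U) * (ψ z - Φ z U)| ≤
      4 / 3 * (Φ x U ^ 3 + Φ y U ^ 3 + Φ z U ^ 3 + ψ x ^ 3 + ψ y ^ 3 + ψ z ^ 3) := fun U =>
    abs_prod_sub_le_cubes (hΦ0 x U) (hΦ0 y U) (hΦ0 z U) (hψ0 x) (hψ0 y) (hψ0 z)
  have hsum_int : Integrable (fun U => Φ x U ^ 3 + Φ y U ^ 3 + Φ z U ^ 3 + ψ x ^ 3 + ψ y ^ 3 + ψ z ^ 3)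
      (wilsonMeasure (d := 4) (L := 2 * L + 1) r.ρ β) :=
    (((((hΦ3int x).add (hΦ3int y)).add (hΦ3int z)).add (integrable_const _)).add (integrable_const _)).add
      (integrable_const _)
  have hrhs_int : Integrable (fun U => 4 / 3 * (Φ x U ^ 3 + Φ y U ^ 3 + Φ z U ^ 3 + ψ x ^ 3 + ψ y ^ 3 + ψ z ^ 3))
      (wilsonMeasure (d := 4) (L := 2 * L + 1) r.ρ β) := hsum_int.const_mul _
  rw [hK3]
  calc |∫ U, (ψ x - Φ x U) * (ψ y - Φ y U) * (ψ z - Φ z U) ∂(wilsonMeasure (d := 4) (L := 2 * L + 1) r.ρ β)|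
      ≤ ∫ U, |(ψ x - Φ x U) * (ψ y - Φ y U) * (ψ z - Φ z U)| ∂(wilsonMeasure (d := 4) (L := 2 * L + 1) r.ρ β) :=
        abs_integral_le_integral_abs
    _ ≤ ∫ U, 4 / 3 * (Φ x U ^ 3 + Φ y U ^ 3 + Φ z U ^ 3 + ψ x ^ 3 + ψ y ^ 3 + ψ z ^ 3)
          ∂(wilsonMeasure (d := 4) (L := 2 * L + 1) r.ρ β) :=
        integral_mono_of_nonneg (ae_of_all _ fun U => abs_nonneg _) hrhs_int (ae_of_all _ hpt)
    _ = 4 / 3 * ((∫ U, Φ x U ^ 3 ∂(wilsonMeasure (d := 4) (L := 2 * L + 1) r.ρ β)) +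
          (∫ U, Φ y U ^ 3 ∂(wilsonMeasure (d := 4) (L := 2 * L + 1) r.ρ β)) +
          (∫ U, Φ z U ^ 3 ∂(wilsonMeasure (d := 4) (L := 2 * L + 1) r.ρ β)) +
          ψ x ^ 3 + ψ y ^ 3 + ψ z ^ 3) := by
        rw [integral_const_mul, integral_add, integral_add, integral_add, integral_add, integral_add,
          integral_const, integral_const, integral_const]
        · simp
        · exact hΦ3int x
        · exact hΦ3int y
        · exact (hΦ3int x).add (hΦ3int y)
        · exact hΦ3int z
        · exact ((hΦ3int x).add (hΦ3int y)).add (hΦ3int z)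
        · exact integrable_const _
        · exact (((hΦ3int x).add (hΦ3int y)).add (hΦ3int z)).add (integrable_const _)
        · exact integrable_const _
        · exact ((((hΦ3int x).add (hΦ3int y)).add (hΦ3int z)).add (integrable_const _)).add (integrable_const _)
        · exact integrable_const _
    _ ≤ 4 / 3 * (m ^ 3 * K₃ / β ^ 3 + m ^ 3 * K₃ / β ^ 3 + m ^ 3 * K₃ / β ^ 3 +
          (6 * K₁) ^ 3 / β ^ 3 + (6 * K₁) ^ 3 / β ^ 3 + (6 * K₁) ^ 3 / β ^ 3) := by
        gcongr
        · exact hcube x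
        · exact hcube y
        · exact hcube z
        · exact hψ3 x
        · exact hψ3 y
        · exact hψ3 z
    _ = 4 * (m ^ 3 * K₃ + (6 * K₁) ^ 3) / β ^ 3 := by ring

end K3

/-! ## §3 The sharp `Q3` ceiling at every unit, uniformly in the odd torus -/

section Q3Sharp

variable {G : Type} [Group G] [TopologicalSpace G] [IsTopologicalGroup G] [CompactSpace G]
  [MeasurableSpace G] [BorelSpace G] (r : LatticeRep G)

/-- **`Q3` at weak coupling, every unit, every odd torus, NO logarithm**: for a lattice representation `r` and test functions
`f, g, h` there is `K ≥ 0` with `|Q3 G r β L s f g h| ≤ K/(β³·min(s,1)¹²)` for all `L ≥ 1`, `β ≥ 4`, `s > 0`. [folklore] -/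
theorem exists_abs_Q3_le_sharp (f g h : 𝓢((EuclideanSpace ℝ (Fin 4)), ℝ)) :
    ∃ K : ℝ, 0 ≤ K ∧ ∀ (L : ℕ), 1 ≤ L → ∀ β : ℝ, 4 ≤ β → ∀ s : ℝ, 0 < s →
      |Q3 G r β L s f g h| ≤ K / (β ^ 3 * (min s 1) ^ 12) := by
  obtain ⟨W, hW0, hW⟩ := exists_abs_torusK3_le_sharp r
  obtain ⟨Kf, hKf0, hKf⟩ := exists_sum_abs_schwartz_lattice_le_div_min f
  obtain ⟨Kg, hKg0, hKg⟩ := exists_sum_abs_schwartz_lattice_le_div_min g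
  obtain ⟨Kh, hKh0, hKh⟩ := exists_sum_abs_schwartz_lattice_le_div_min h
  refine ⟨Kf * Kg * Kh * W, by positivity, fun L hL β hβ s hs => ?_⟩
  have hβ0 : 0 < β := by linarith
  have hs'0 : 0 < min s 1 := lt_min hs one_pos
  have hpt := Summit.QuantumFields.YangMills.Cruxes.NT.CeilingPrice.abs_Q3_le_of_pointwise G r β L s f g h
    (B := W / β ^ 3) fun x _ y _ z _ _ _ _ => hW L hL β hβ x y z
  have hF := hKf s hs (box 4 L)
  have hG := hKg s hs (box 4 L)
  have hH := hKh s hs (box 4 L)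
  have hFn : 0 ≤ ∑ x ∈ box 4 L, |f (s • siteToE x)| := Finset.sum_nonneg fun _ _ => abs_nonneg _
  have hGn : 0 ≤ ∑ y ∈ box 4 L, |g (s • siteToE y)| := Finset.sum_nonneg fun _ _ => abs_nonneg _
  have hHn : 0 ≤ ∑ z ∈ box 4 L, |h (s • siteToE z)| := Finset.sum_nonneg fun _ _ => abs_nonneg _
  have hB0 : 0 ≤ W / β ^ 3 := by positivity
  calc |Q3 G r β L s f g h|
      ≤ (∑ x ∈ box 4 L, |f (s • siteToE x)|) * (∑ y ∈ box 4 L, |g (s • siteToE y)|) *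
          (∑ z ∈ box 4 L, |h (s • siteToE z)|) * (W / β ^ 3) := hpt
    _ ≤ (Kf / (min s 1) ^ 4) * (Kg / (min s 1) ^ 4) * (Kh / (min s 1) ^ 4) * (W / β ^ 3) := by gcongr
    _ = Kf * Kg * Kh * W / (β ^ 3 * (min s 1) ^ 12) := by field_simp

end Q3Sharp

/-! ## §4 The unit envelope of an NT unit from clause (ii): `a(β) ≤ K^{1/12} β^{−1/4}` -/

section Envelope

variable {G : Type} [Group G] [TopologicalSpace G] [IsTopologicalGroup G] [CompactSpace G]
  [MeasurableSpace G] [BorelSpace G]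

/-- **A three-point floor calibrates the unit (coarse side)**: if a positive unit map `a` carries `ε ≤ |Q3 G r β L (a β) f g h|`
(`ε > 0`) on SOME torus `2L+1`, `L ≥ 1`, for every `β ≥ β₅`, then `min(a β, 1)¹² · β³ ≤ K` for all `β ≥ max β₅ 4`. [folklore] -/
theorem unit_pow_twelve_le_of_q3Floor_sharp (r : LatticeRep G) (a : ℝ → ℝ) (ha : ∀ β, 0 < a β)
    (f g h : 𝓢(EuclideanSpace ℝ (Fin 4), ℝ)) {ε β₅ : ℝ} (hε : 0 < ε)
    (hfloor : ∀ β : ℝ, β₅ ≤ β → ∃ L : ℕ, 1 ≤ L ∧ ε ≤ |Q3 G r β L (a β) f g h|) :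
    ∃ K : ℝ, 0 ≤ K ∧ ∀ β : ℝ, max β₅ 4 ≤ β → (min (a β) 1) ^ 12 * β ^ 3 ≤ K := by
  obtain ⟨K, hK0, hK⟩ := exists_abs_Q3_le_sharp r f g h
  refine ⟨K / ε, div_nonneg hK0 hε.le, fun β hβ => ?_⟩
  have hβ5 : β₅ ≤ β := le_trans (le_max_left _ _) hβ
  have hβ4 : 4 ≤ β := le_trans (le_max_right _ _) hβ
  obtain ⟨L, hL1, hlo⟩ := hfloor β hβ5
  have hup := hK L hL1 β hβ4 (a β) (ha β)
  have hm0 : 0 < min (a β) 1 := lt_min (ha β) one_pos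
  have hβ0 : 0 < β := by linarith
  have hden : 0 < β ^ 3 * (min (a β) 1) ^ 12 := by positivity
  have h1 : ε ≤ K / (β ^ 3 * (min (a β) 1) ^ 12) := hlo.trans hup
  rw [le_div_iff₀ hden] at h1
  rw [le_div_iff₀ hε]
  linarith [mul_comm ε (β ^ 3 * (min (a β) 1) ^ 12)]

/-- **Clause (ii) pins the unit**: `LowerBounds G r a`, `0 < a` ⇒ for all large `β`, `a β < 1` and `a β ^ 12 ≤ K / β³`. [folklore] -/
theorem unit_pow_twelve_le_of_lowerBounds (r : LatticeRep G) (a : ℝ → ℝ) (ha : ∀ β, 0 < a β)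
    (hlb : LowerBounds G r a) :
    ∃ K β₁ : ℝ, 0 ≤ K ∧ ∀ β : ℝ, β₁ ≤ β → a β < 1 ∧ a β ^ 12 ≤ K / β ^ 3 := by
  obtain ⟨-, ⟨f, g, h, ε, β₅, Λ₅, -, -, -, hε, hfloor⟩⟩ := hlb
  have hfl : ∀ β : ℝ, β₅ ≤ β → ∃ L : ℕ, 1 ≤ L ∧ ε ≤ |Q3 G r β L (a β) f g h| := by
    intro β hβ
    refine ⟨⌈Λ₅ / a β⌉₊ + 1, by omega, hfloor β hβ _ ?_⟩
    have h1 : Λ₅ / a β ≤ (⌈Λ₅ / a β⌉₊ : ℝ) := Nat.le_ceil _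
    have h2 : (⌈Λ₅ / a β⌉₊ : ℝ) ≤ ((⌈Λ₅ / a β⌉₊ + 1 : ℕ) : ℝ) := by push_cast; linarith
    have h3 : Λ₅ / a β ≤ ((⌈Λ₅ / a β⌉₊ + 1 : ℕ) : ℝ) := h1.trans h2
    rw [div_le_iff₀ (ha β)] at h3
    linarith [mul_comm (((⌈Λ₅ / a β⌉₊ + 1 : ℕ) : ℝ)) (a β)]
  obtain ⟨K, hK0, hK⟩ := unit_pow_twelve_le_of_q3Floor_sharp r a ha f g h hε hfl
  refine ⟨K, max (max β₅ 4) (K + 1), hK0, fun β hβ => ?_⟩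
  have h1 := hK β (le_trans (le_max_left _ _) hβ)
  have hβK : K + 1 ≤ β := le_trans (le_max_right _ _) hβ
  have hβ4 : 4 ≤ β := le_trans (le_max_right _ _) (le_trans (le_max_left _ _) hβ)
  have hβ1 : 1 ≤ β := by linarith
  have hβ3 : 0 < β ^ 3 := by positivity
  -- `K < β ≤ β³`
  have hKlt : K < β ^ 3 := by
    have hb : β ≤ β ^ 3 := by
      calc β = β ^ 1 := (pow_one β).symm
        _ ≤ β ^ 3 := pow_le_pow_right₀ hβ1 (by norm_num)
    linarith
  have h3 : (min (a β) 1) ^ 12 ≤ K / β ^ 3 := by rw [le_div_iff₀ hβ3]; exact h1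
  have h4 : K / β ^ 3 < 1 := (div_lt_one hβ3).2 hKlt
  have hm0 : 0 ≤ min (a β) 1 := le_min (ha β).le zero_le_one
  have hlt : min (a β) 1 < 1 := by
    by_contra hge
    rw [not_lt] at hge
    have : (1 : ℝ) ≤ (min (a β) 1) ^ 12 := one_le_pow₀ hge
    linarith
  have hmin : min (a β) 1 = a β := min_eq_left (le_of_lt (by simpa using (min_lt_iff.1 hlt)))
  exact ⟨by simpa [hmin] using hlt, by simpa [hmin] using h3⟩

end Envelope

end Summit.QuantumFields.YangMills.Cruxes.NT.SharpCeilings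

end
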